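import Summits.AtomisticToContinuum.Crystallization.Theorems.FrustratedLawDichotomyStrainedPatchHomCurvLeafL2

/-!
# KERNEL TEST of the centred curvature leaf v2: hcp⋆ box `U ± 2⁻⁹ × ξ ± 0.005`, production label split, floor `λ = 6`

decomp-a2c hand-1 g27 (crux `AperiodicFrustratedLawGap`, stmt-AtomisticToContinuum-27623; `(H) HomFloor (1/625)`, hcp half; lever (C)).  Same box
and label selection as `…HomCurvLeafLSmoke` (`cStar2 = cStarL`, `wStar2 = wStarL`; centred = `labelOK2` and `ρ₀ < 2`), with the v2 displacement enclosure:
compiled evaluation of `curvCheckL2`'s pieces gives matrix floor `8.42`, with first-order bound `7.38`, remainder `1.23`, certified `6.15`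
(`= 0.72·λ_c`, `λ_c = 8.53`; the ratio asked for by critic rows 1040/1044 is `½`).  The kernel confirms `λ = 6`.  Kernel time ≈ 35 s.

Test data definitions + one kernel theorem; 0 sorry; standard axioms; no instances / notation / `#eval`.  `--supports stmt-AtomisticToContinuum-27623`.
-/

namespace Summit.AtomisticToContinuum.Crystallization.Theorems.FrustratedLawDichotomyStrainedPatchHomCurvLeafL2

open Literature.Analysis.ValidatedNumerics.Numerics
open Summit.AtomisticToContinuum.Crystallization.Theorems.FrustratedLawDichotomyStrainedPatchHomCurvLeaf (nearLabels)
open Summit.AtomisticToContinuum.Crystallization.Theorems.FrustratedLawDichotomyStrainedPatchHomCurvCentreKit (rho0)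

/-- Box centre at hcp⋆: `U = diag(0.97128, 0.97128, 0.9711)` (scaled), `ξ = 0` (same data as `…HomCurvLeafLSmoke.cStarL`). -/
def cStar2 : (Fin 3 × Fin 3) ⊕ Fin 3 → ℤ :=
  Sum.elim (fun ab => if ab.1 = ab.2 then (if ab.1 = 2 then 273340349883718 else 273391015379526) else 0) (fun _ => 0)

/-- Half-widths `2⁻⁹` (entries) and `0.005` (shuffle), scaled (same data as `…HomCurvLeafLSmoke.wStarL`). -/
def wStar2 : (Fin 3 × Fin 3) ⊕ Fin 3 → ℤ := Sum.elim (fun _ => 549755813888) (fun _ => 1407374883553)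

/-- Centred-label selector (v2): `labelOK2` and centre radius `< 2`. -/
def isCenL2 (c w : (Fin 3 × Fin 3) ⊕ Fin 3 → ℤ) (b : Fin 3 → ℤ) : Bool := labelOK2 c w b && decide ((rho0 c b).hi < 2 * (SC : ℤ))

/-- The centred labels of the test box (computed in the kernel, v2). -/
def LcStar2 : List (Fin 3 → ℤ) := (nearLabels cStar2 wStar2 2209 100).filter fun b => isCenL2 cStar2 wStar2 b

/-- The naive labels of the test box (computed in the kernel, v2). -/
def LnStar2 : List (Fin 3 → ℤ) := (nearLabels cStar2 wStar2 2209 100).filter fun b => !(isCenL2 cStar2 wStar2 b)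

/-- ★★ KERNEL TEST: the v2 centred leaf certifies the curvature floor `λ = 6` (`0.70·λ_c`) on the hcp⋆ box `U ± 2⁻⁹ × ξ ± 0.005`. -/
theorem curvCheckL2_star : curvCheckL2 cStar2 wStar2 LcStar2 LnStar2 (6 * 281474976710656) = true := by
  decide +kernel

end Summit.AtomisticToContinuum.Crystallization.Theorems.FrustratedLawDichotomyStrainedPatchHomCurvLeafL2
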